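/-
Copyright (c) 2026 the pub-hodgecm-mathlib formalisation cell (harness21).  Prover seat hodgecm-mathlib-K2E4-p10 (g9), Track B «K2-LIT»,
#184♮ = hLiu418 = `stmt-HodgeConjecture-24832`; socket #41, KIND W, (x-b) of LEAD F0P6-plan (g14) BATCH #62 (1) + desk K2E5-p17 RULING 2026-09-04T22:32:19Z
(«(β): local → global is (x-b)'s genre»).  FILE 2c of this seat's (x-b) chain: the PRODUCT FORMULA AT THE FINITE PLACES, for the finite-size letter `hfsize` of
★∕📤 `K2LiuSiegelEisensteinKindWPresentation.dloc_of_presentation`.  THEOREMS ONLY (no `def`, no `instance`, no notation, no named-fact hypothesis, no `sorry`); Mathlib + ★ `KindWDecay`.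
-/
import Summits.HodgeConjecture.HodgeConjecture.Theorems.K2LiuSiegelEisensteinKindWDecay   -- ★ p862527 (this seat): `apply_entry_le_norm`, `apply_det_le`
import Mathlib.RingTheory.DedekindDomain.Ideal.Lemmas
import Mathlib.RingTheory.Ideal.Norm.AbsNorm
import HarnessLib

/-!
# Crux `HLiu418`, socket #41, KIND W — `K2LiuSiegelEisensteinKindWFinitePlaces`: THE PRODUCT FORMULA AT THE FINITE PLACES —
# `∏_{w ∈ T} N(𝔭_w)^{m_w} ≤ |N_{L∕ℚ}(x)|` whenever `x ∈ 𝔭_w^{m_w}` (`w ∈ T`), and its two KIND-W instances (denominators; `det(D·S)`)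

Cell `hodgecm-mathlib`, crux item hLiu418 = `stmt-HodgeConjecture-24832` (helper lane `--supports … --as helper`, count-neutral), route of record `HCCMUnconditional`;
squad K2 ∕ K2Liu, road `K2_Liu`, socket #41 `sig_K2LiuSiegelEisensteinContinuation`, KIND W.  The presentation assembly (★∕📤 `K2LiuSiegelEisensteinKindWPresentation.dloc_of_presentation`)
takes the FINITE-SIZE letter of a term in the GLOBAL currency `‖∏_{v ∈ T(S,h)} F_{v,j} S s h‖ ≤ C ‖h‖^a (1 + τ S)^{N₂} D(S)^{N₃}` (`D(S)` the least denominator of `S`).  The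
local theory (★ Φ4 `goodPlace_whittaker_norm_le`, ★ Φ5∕S-a Skew-ball bounds) bounds each `F_{v,j}` by `q_v^{c·K_v}` with `K_v` linear in the conductor exponent, the
DENOMINATOR exponents of `S` and of `S⁻¹` at the places over `v`, and the level of `h_v`; multiplying over the places, the denominators of `S` are paid by `D^{[L:ℚ]}`, those of
`S⁻¹ = D·adj(D S)∕det(D S)` by `|N_{L∕ℚ}(det(D·S))| ≤ (n!·(D τ)^n)^{[L:ℚ]}`, and the levels by `∏_w H_w(h) ≤ N‖h‖` (★ `K2LiuSiegelEisensteinKindWInstance.finprod_localHeight_le`).  THIS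
FILE supplies the arithmetic of the first two conversions, generic and Mathlib-only:
* §1 **`prod_pow_absNorm_le_natAbs_norm`** — for `x ∈ 𝓞_L ∖ 0`, a finite set `T` of places and exponents `m` with `x ∈ 𝔭_w^{m_w}` (`w ∈ T`):
  `∏_{w∈T} N(𝔭_w)^{m_w} ≤ |N_{𝓞_L∕ℤ}(x)|` (`(x) ≤ ⨅ 𝔭_w^{m_w} = ∏ 𝔭_w^{m_w}` by ★ Mathlib `HeightOneSpectrum.inf_pow_eq_prod`, then `Ideal.absNorm_dvd_absNorm_of_le`, `Ideal.absNorm_span_singleton`);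
  `prod_pow_absNorm_le_abs_norm_of_valuation_le` — the same for `y : L` integral over `ℤ`, `y ≠ 0`, from the VALUATION letters `|y|_w ≤ q_w^{−m_w}` (★ Mathlib
  `valuedAdicCompletion_eq_valuation'`, `valuation_of_algebraMap`, `intValuation_le_pow_iff_mem`), in the real currency `≤ |N_{L∕ℚ}(y)|`;
* §2 `abs_norm_le_pow_of_apply_le` — `|N_{L∕ℚ}(y)| ≤ B^{[L:ℚ]}` when `|y|_w ≤ B` at every infinite place (★ Mathlib `InfinitePlace.prod_eq_abs_norm`, `sum_mult_eq`);
* §3 the two KIND-W instances: **`prod_pow_absNorm_le_pow_finrank_natCast`** (`x = D`: `∏_{w∈T} N(𝔭_w)^{m_w} ≤ D^{[L:ℚ]}` when `|D|_w ≤ q_w^{−m_w}`) and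
  **`prod_pow_absNorm_le_of_det_smul`** (`x = det(D·S)`: `≤ (n!·(D(1+τ))^n)^{[L:ℚ]}` when `|det(D·S)|_w ≤ q_w^{−m_w}`, `‖(ι_∞ S_{ab})‖ ≤ τ`; ★ `apply_det_le`).
[NeukirchANT1999, Ch. I §3 (3.1)–(3.3), Ch. III §1 (product formula)], [CasselsFrohlichANT1967, Ch. II §11–§12], [Shimura1997, §18.4 Prop. 18.14].
HONEST LABEL.  Count-neutral helper, closes no socket: `HC_CM` is proved only modulo the 7 printed citations (2 remaining named inputs: hLiu418 =
`stmt-HodgeConjecture-24832`, h413 = `stmt-HodgeConjecture-24833`) until rung 0 closes.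
-/

set_option autoImplicit false
set_option linter.dupNamespace false -- the mandated namespace repeats `HodgeConjecture.HodgeConjecture`

noncomputable section

namespace Summit.HodgeConjecture.HodgeConjecture.Cruxes.HLiu418.K2LiuSiegelEisensteinKindWFinitePlaces

open scoped BigOperators NNReal
-- `Classical` is needed to see the Mathlib normed-ring instances on `mixedSpace L` (note H5 of ★ `AdelicGLnGlue`)
open scoped Classical
open NumberField NumberField.mixedEmbedding NumberField.InfinitePlace IsDedekindDomain
open Summit.HodgeConjecture.HodgeConjecture.Cruxes.HLiu418.K2LiuSiegelEisensteinKindWDecay (apply_entry_le_norm apply_det_le)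

variable (L : Type) [Field L] [NumberField L]

/-! ## §1 The product formula at the finite places, as an inequality -/

/-- **`∏_{w∈T} N(𝔭_w)^{m_w} ≤ |N(x)|` FOR `x ∈ 𝓞_L ∖ 0` WITH `x ∈ 𝔭_w^{m_w}` (`w ∈ T`)**: the principal ideal `(x)` lies in `⨅_{w∈T} 𝔭_w^{m_w} = ∏_{w∈T} 𝔭_w^{m_w}` (distinct primes,
★ Mathlib `HeightOneSpectrum.inf_pow_eq_prod`), so the absolute norm of the product divides `N((x)) = |N_{𝓞_L∕ℤ}(x)| ≠ 0`.
[cite: NeukirchANT1999, Ch. I §3 (3.3)] [cite: CasselsFrohlichANT1967, Ch. II §11] -/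
theorem prod_pow_absNorm_le_natAbs_norm (x : 𝓞 L) (hx : x ≠ 0) (T : Finset (HeightOneSpectrum (𝓞 L))) (m : HeightOneSpectrum (𝓞 L) → ℕ)
    (hm : ∀ w ∈ T, x ∈ w.asIdeal ^ m w) :
    ∏ w ∈ T, Ideal.absNorm w.asIdeal ^ m w ≤ (Algebra.norm ℤ x).natAbs := by
  have hle : Ideal.span ({x} : Set (𝓞 L)) ≤ ∏ w ∈ T, w.asIdeal ^ m w := by
    rw [← HeightOneSpectrum.inf_pow_eq_prod T m (fun w => w) fun i _ j _ hij => hij, Finset.le_inf_iff]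
    intro w hw
    rw [Ideal.span_singleton_le_iff_mem]
    exact hm w hw
  have hdvd := Ideal.absNorm_dvd_absNorm_of_le hle
  rw [Ideal.absNorm_span_singleton, map_prod] at hdvd
  simp only [map_pow] at hdvd
  refine Nat.le_of_dvd (Int.natAbs_pos.2 ?_) hdvd
  exact Algebra.norm_ne_zero_iff.2 hx

/-- **THE SAME FROM VALUATION LETTERS, FOR `y ∈ L` INTEGRAL OVER `ℤ`**: `y ≠ 0`, `IsIntegral ℤ y`, and `|y|_w ≤ q_w^{−m_w}` at the places `w ∈ T` ⟹
`∏_{w∈T} N(𝔭_w)^{m_w} ≤ |N_{L∕ℚ}(y)|` (real currency; ★ Mathlib `valuedAdicCompletion_eq_valuation'`, `valuation_of_algebraMap`, `intValuation_le_pow_iff_mem`, `Algebra.coe_norm_int`).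
[cite: NeukirchANT1999, Ch. II §3, Ch. III §1] [cite: CasselsFrohlichANT1967, Ch. II §12] -/
theorem prod_pow_absNorm_le_abs_norm_of_valuation_le (y : L) (hy0 : y ≠ 0) (hy : IsIntegral ℤ y)
    (T : Finset (HeightOneSpectrum (𝓞 L))) (m : HeightOneSpectrum (𝓞 L) → ℕ)
    (hm : ∀ w ∈ T, Valued.v (y : w.adicCompletion L) ≤ WithZero.exp (-(m w : ℤ))) :
    ∏ w ∈ T, ((Ideal.absNorm w.asIdeal : ℕ) : ℝ) ^ m w ≤ |((Algebra.norm ℚ y : ℚ) : ℝ)| := by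
  -- `y` as an element `x` of `𝓞 L`
  set x : 𝓞 L := ⟨y, (mem_integralClosure_iff ℤ L).2 hy⟩ with hxdef
  have hxy : (x : L) = y := rfl
  have hx0 : x ≠ 0 := fun h => hy0 (by rw [← hxy, h]; rfl)
  have hmem : ∀ w ∈ T, x ∈ w.asIdeal ^ m w := by
    intro w hw
    rw [← HeightOneSpectrum.intValuation_le_pow_iff_mem, ← HeightOneSpectrum.valuation_of_algebraMap (K := L),
      ← HeightOneSpectrum.valuedAdicCompletion_eq_valuation']
    exact hm w hw
  have hnat := prod_pow_absNorm_le_natAbs_norm L x hx0 T m hmem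
  -- cast to `ℝ`: `|N_ℚ(y)| = |N_ℤ(x)| = natAbs`
  have hcast : |((Algebra.norm ℚ y : ℚ) : ℝ)| = ((Algebra.norm ℤ x).natAbs : ℝ) := by
    rw [← hxy, ← Algebra.coe_norm_int, Rat.cast_intCast, ← Int.cast_abs, Int.abs_eq_natAbs, Int.cast_natCast]
  rw [hcast]
  exact_mod_cast hnat

/-! ## §2 The archimedean size of the norm -/

/-- **`|N_{L∕ℚ}(y)| ≤ B^{[L:ℚ]}`** when `|y|_w ≤ B` at every infinite place `w` (`∏_w |y|_w^{mult w} = |N(y)|`, `Σ_w mult w = [L:ℚ]`).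
[cite: NeukirchANT1999, Ch. I §5] -/
theorem abs_norm_le_pow_of_apply_le (y : L) {B : ℝ} (hB : ∀ w : InfinitePlace L, w y ≤ B) :
    |((Algebra.norm ℚ y : ℚ) : ℝ)| ≤ B ^ Module.finrank ℚ L := by
  have hB0 : 0 ≤ B := by
    obtain ⟨w⟩ := (inferInstance : Nonempty (InfinitePlace L))
    exact (apply_nonneg w y).trans (hB w)
  have h := InfinitePlace.prod_eq_abs_norm y
  have hcast : |((Algebra.norm ℚ y : ℚ) : ℝ)| = ((|Algebra.norm ℚ y| : ℚ) : ℝ) := (Rat.cast_abs _).symm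
  rw [hcast, ← h, ← InfinitePlace.sum_mult_eq (K := L), ← Finset.prod_pow_eq_pow_sum]
  exact Finset.prod_le_prod (fun w _ => pow_nonneg (apply_nonneg w y) _) fun w _ => pow_le_pow_left₀ (apply_nonneg w y) (hB w) _

/-! ## §3 The two KIND-W instances: denominators, and `det(D·S)` -/

/-- **DENOMINATORS ARE PAID BY `D^{[L:ℚ]}`**: for `D ≥ 1` and exponents with `|D|_w ≤ q_w^{−m_w}` on `T` (e.g. `m_w` = the denominator exponent of an entry of `S` at `w` when
`D·S` is integral): `∏_{w∈T} N(𝔭_w)^{m_w} ≤ D^{[L:ℚ]}`. [cite: NeukirchANT1999, Ch. III §1] -/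
theorem prod_pow_absNorm_le_pow_finrank_natCast {D : ℕ} (hD : 1 ≤ D) (T : Finset (HeightOneSpectrum (𝓞 L))) (m : HeightOneSpectrum (𝓞 L) → ℕ)
    (hm : ∀ w ∈ T, Valued.v (((D : L)) : w.adicCompletion L) ≤ WithZero.exp (-(m w : ℤ))) :
    ∏ w ∈ T, ((Ideal.absNorm w.asIdeal : ℕ) : ℝ) ^ m w ≤ (D : ℝ) ^ Module.finrank ℚ L := by
  have hD0 : (D : L) ≠ 0 := by exact_mod_cast (show D ≠ 0 by omega)
  have hint : IsIntegral ℤ ((D : L)) := by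
    have h : IsIntegral ℤ (algebraMap ℤ L (D : ℤ)) := isIntegral_algebraMap
    rwa [map_natCast] at h
  refine (prod_pow_absNorm_le_abs_norm_of_valuation_le L (D : L) hD0 hint T m hm).trans (le_of_eq ?_)
  have hnorm : Algebra.norm ℚ ((D : L)) = (D : ℚ) ^ Module.finrank ℚ L := by
    rw [← map_natCast (algebraMap ℚ L) D, Algebra.norm_algebraMap]
  rw [hnorm, Rat.cast_pow, Rat.cast_natCast, abs_of_nonneg (pow_nonneg (Nat.cast_nonneg D) _)]

/-- **`det(D·S)` IS PAID BY `(D^n · n! · (1+τ)^n)^{[L:ℚ]}`**: for `S ∈ M_n(L)` with `det S ≠ 0`, `D ≥ 1` with `D·S_{ab}` integral over `ℤ`, `‖(ι_∞ S_{ab})‖ ≤ τ`, and exponents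
with `|det(D·S)|_w ≤ q_w^{−m_w}` on `T` (e.g. `m_w = ord_w det(D·S)`, which pays the denominators of `S⁻¹ = D·adj(D S)∕det(D S)`):
`∏_{w∈T} N(𝔭_w)^{m_w} ≤ (D^n · (n!·(1+τ)^n))^{[L:ℚ]}` (§1 at `y = det(D·S) = D^n det S`, §2 with `|det S|_w ≤ n!·τ^n` ★ `apply_det_le`).
[cite: NeukirchANT1999, Ch. III §1] [cite: Shimura1997, §18.4 Prop. 18.14] -/
theorem prod_pow_absNorm_le_of_det_smul {n : ℕ} (S : Matrix (Fin n) (Fin n) L) (hdet : S.det ≠ 0) {D : ℕ} (hD : 1 ≤ D)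
    (hDint : ∀ a b, IsIntegral ℤ ((D : L) * S a b)) {τ : ℝ} (hτ : ‖fun a b => mixedEmbedding L (S a b)‖ ≤ τ)
    (T : Finset (HeightOneSpectrum (𝓞 L))) (m : HeightOneSpectrum (𝓞 L) → ℕ)
    (hm : ∀ w ∈ T, Valued.v ((((D : L) • S).det : L) : w.adicCompletion L) ≤ WithZero.exp (-(m w : ℤ))) :
    ∏ w ∈ T, ((Ideal.absNorm w.asIdeal : ℕ) : ℝ) ^ m w ≤ ((D : ℝ) ^ n * ((n.factorial : ℝ) * (1 + τ) ^ n)) ^ Module.finrank ℚ L := by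
  have hτ0 : 0 ≤ τ := (norm_nonneg _).trans hτ
  have hD0 : (D : L) ≠ 0 := by exact_mod_cast (show D ≠ 0 by omega)
  have hDS : ((D : L) • S).det = (D : L) ^ n * S.det := by rw [Matrix.det_smul, Fintype.card_fin]
  have hy0 : ((D : L) • S).det ≠ 0 := by rw [hDS]; exact mul_ne_zero (pow_ne_zero _ hD0) hdet
  have hyint : IsIntegral ℤ ((D : L) • S).det :=
    IsIntegral.det fun a b => by rw [Matrix.smul_apply, smul_eq_mul]; exact hDint a b
  refine (prod_pow_absNorm_le_abs_norm_of_valuation_le L _ hy0 hyint T m hm).trans (abs_norm_le_pow_of_apply_le L _ fun w => ?_)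
  rw [hDS, map_mul, map_pow, InfinitePlace.map_natCast]
  have h1 : w S.det ≤ (n.factorial : ℝ) * (1 + τ) ^ n :=
    (apply_det_le L w S hτ).trans (mul_le_mul_of_nonneg_left (pow_le_pow_left₀ hτ0 (by linarith) n) (Nat.cast_nonneg _))
  exact mul_le_mul_of_nonneg_left h1 (pow_nonneg (Nat.cast_nonneg D) n)

end Summit.HodgeConjecture.HodgeConjecture.Cruxes.HLiu418.K2LiuSiegelEisensteinKindWFinitePlaces

end
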